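import Literature.AlgebraicGeometry.Frobenioids.ArchimedeanProp35iCounterexampleNA
import Literature.AlgebraicGeometry.Frobenioids.ArchimedeanQuotientLiftingRigidAsTyped
import Literature.AlgebraicGeometry.Frobenioids.ArchimedeanUnitCircle
import HarnessLib

/-!
# Frobenioids II, Proposition 3.5 (i) AS TYPED ⟺ Galois saturation of the quotient data: the EXACT
# content of finding P35i-F1 (the repair hypothesis of GAP-LEDGER G-w4d100-1 is necessary and sufficient)

Mochizuki, *The geometry of Frobenioids II: poly-Frobenioids*, Kyushu J. Math. **62** (2008) 401–460,
§3, Proposition 3.5 (i), kurims p. 34 [cite: MochizukiFrdII2008, Prop 3.5 (i) p.34]: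
"Let `A ∈ Ob(H)`; suppose that `B_D → A_D := Base(A)` is a mono-minimal categorical quotient of `B_D` by a
group `G_D ⊆ Aut_D(B_D)` in `D`. Then there exists a pull-back morphism `B → A` that lifts `B_D → A_D`
and a group `G ⊆ Aut_H(B)` that maps isomorphically to `G_D` such that `B → A` is a mono-minimal
categorical quotient of `B` by `G` in `H`."

PROOF-ONLY file (abc-iut-w4-d100, gen 2). For the typed instances `Prop35i_C`, `Prop35i_A`, `Prop35i_N`
of abc-iut-L1-t9 (FACT-LIST F-0858, F-0857, F-0859 — universal closure refuted: `not_prop35i_C_collapse`,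
`not_prop35i_CAN_collapse`) over an ARBITRARY functor `π : D → D₀`, this file proves that each holds
**if and only if** every mono-minimal categorical quotient datum `(B_D → Base(A), G_D)` under an object
of `C` is Galois-saturated for `π` (`ArchFrd.GaloisSaturated`, abc-iut-w4-d100 gen 0: some element of `G_D`
maps to complex conjugation whenever `π B_D` is complex over a real `π A_D`):
* sufficiency is gen 0's repaired Proposition (`prop35iR_C_holds`, `prop35iR_A_holds`, `prop35iR_N_holds`);
* NECESSITY (`galoisSaturated_of_prop35i_C/_A/_N`): if some datum is unsaturated, then `π(G_D)` is trivial
  on `Spec ℂ = π B_D` while `A` is real, so for ANY lift `(B, f, Γ)` as in the conclusion every `γ ∈ Γ`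
  has `C₀`-component over the identity (compatibility of `Γ ≃ G_D` with the base), and the phase twist
  `ψ = (b, d, i · c_f)` of `f` (`exists_phaseTwist'`, for any base) is a `Γ`-invariant arrow of `H` that
  does not factor through `f`;
* hence **`prop35i_C_iff_saturated`**, **`prop35i_A_iff_saturated`**, **`prop35i_N_iff_saturated`** and the
  coincidences **`prop35i_A_iff_C`**, **`prop35i_N_iff_C`** — the three refutable instances are ONE
  condition on the base `π : D → D₀`; the fourth instance `Prop35i_R` holds for every base
  (`ArchFrd.Prop35i_R_holds`).
So the hypothesis added in the repaired statement `Prop35iR` (G-w4d100-1) is not merely sufficient: it is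
exactly what the printed item (for `C`, `A`, `N`) asserts about the base, datum by datum. Nothing here
bears on [IUTchIII] Cor. 3.12; typed ≠ proved except where a `theorem` says so.
-/

namespace Literature.AlgebraicGeometry.Frobenioids

open CategoryTheory
open scoped Pointwise

noncomputable section

namespace ArchFrd

universe v u

/-! ### Small `D₀` facts -/

namespace D0

/-- An object of `D₀` with a nontrivial endomorphism is complex. [cite: MochizukiFrdII2008, Def 3.1 (i) p.23] -/
theorem isComplex_of_endo_ne_id {K : D0} (σ : K ⟶ K) (h : σ ≠ 𝟙 K) : K.IsComplex := by
  cases K with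
  | real => exact absurd (Subsingleton.elim _ _) h
  | complex => rfl

/-- Two endomorphisms of an object of `D₀` that both differ from a NONTRIVIAL one … : an endomorphism
different from a nontrivial endomorphism `σ` is the identity (`End(Spec ℂ) = {1, conj}`).
[cite: MochizukiFrdII2008, Def 3.1 (i) p.23] -/
theorem eq_id_of_ne_of_ne_id {K : D0} (σ τ : K ⟶ K) (hσ : σ ≠ 𝟙 K) (hτ : τ ≠ σ) : τ = 𝟙 K := by
  cases K with
  | real => exact Subsingleton.elim _ _
  | complex =>
    rcases hom_complex_complex_eq σ with h | h
    · exact absurd h hσ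
    · rcases hom_complex_complex_eq τ with h' | h'
      · exact h'
      · exact absurd (h'.trans h.symm) hτ

end D0

/-! ### The phase twist over an arbitrary base -/

section Twist

variable {D : Type u} [Category.{v} D] (π : D ⥤ D0) {B A : C π}

/-- **The phase twist, for any base `π : D → D₀`.** For an arrow `f = (f₀, f_D) : B → A` of `C` from a
COMPLEX object `B` to a REAL object `A` there is an arrow `ψ := ((Base f₀, deg f₀, i · c_{f₀}), f_D) : B → A`
(the region of `A` is isotropic and `|i| = 1`) which (a) is an isometry when `f` is, of the same Frobenius
degree; (b) is fixed by every endomorphism `γ` of `B` fixing `f` whose `C₀`-component lies over the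
identity of `D₀`; (c) does NOT factor through `f` (the factor would be an endomorphism of the real object
`A` with scalar `i ∉ ℝ^×`). [cite: MochizukiFrdII2008, Prop 3.5 (i) p.34] -/
theorem exists_phaseTwist' (hBc : B.fst.base.IsComplex) (hAr : A.fst.base.IsReal) (fC : B ⟶ A) :
    ∃ ψ : B ⟶ A,
      (PreFrobenioid.isometricMorphisms (C.toElem π) fC → PreFrobenioid.isometricMorphisms (C.toElem π) ψ) ∧
        C0.degFr ψ.fst = C0.degFr fC.fst ∧
        (∀ γ : B ⟶ B, C0.Base γ.fst = 𝟙 _ → γ ≫ fC = fC → γ ≫ ψ = ψ) ∧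
        ∀ ψ' : A ⟶ A, fC ≫ ψ' ≠ ψ := by
  have hiso : A.fst.region.IsIsotropic := A.fst.isIsotropic_of_isReal hAr
  have hscB : D0.scalars B.fst.base = ⊤ := by
    unfold D0.IsComplex at hBc
    rw [hBc, D0.scalars_complex]
  have hscA : D0.scalars A.fst.base = D0.scalars D0.real := by
    unfold D0.IsReal at hAr
    rw [hAr]
  -- the `C₀`-arrow `(Base f₀, deg f₀, i · c_{f₀})`
  let ψ₀ : B.fst ⟶ A.fst :=
    { base := C0.Base fC.fst
      degFr := C0.degFr fC.fst
      scalar := unitI * C0.scalar fC.fst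
      scalar_mem := by
        rw [hscB]
        exact Subgroup.mem_top _
      mapsTo := by
        have hf := (fC.fst).mapsTo
        intro x hx
        obtain ⟨y, hy, rfl⟩ := Set.mem_smul_set.mp hx
        have hy' : C0.scalar fC.fst • y ∈ C0.pullRegion A.fst (C0.Base fC.fst) :=
          hf (Set.smul_mem_smul_set hy)
        unfold C0.pullRegion at hy' ⊢
        rw [C0.image_galAct_of_isIsotropic hiso] at hy' ⊢
        rw [C0.mem_carrier_of_isIsotropic hiso] at hy' ⊢
        rw [smul_eq_mul] at hy' ⊢
        rw [mul_assoc, map_mul, absHom_unitI, one_mul]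
        exact hy' }
  let ψ : B ⟶ A := ⟨ψ₀, fC.snd, fC.w⟩
  refine ⟨ψ, fun hf => ?_, rfl, fun γ hγb h1 => ?_, fun ψ' hC => ?_⟩
  · -- (a) same `Div` as `f` (`|i| = 1`)
    have hdiv : C0.div ψ₀ = C0.div fC.fst := by
      have hr : C0.ratio ψ₀ = C0.ratio fC.fst := by
        unfold C0.ratio
        change _ / (‖((unitI * C0.scalar fC.fst : ℂˣ) : ℂ)‖ * _ ^ (C0.degFr fC.fst : ℕ)) =
          _ / (‖(C0.scalar fC.fst : ℂ)‖ * _ ^ (C0.degFr fC.fst : ℕ))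
        rw [Units.val_mul, norm_mul]
        simp [unitI]
      unfold C0.div
      simp only [hr]
    have e1 : PreFrobenioid.Div C0.toElem ψ.fst = PreFrobenioid.Div C0.toElem fC.fst := hdiv
    have key : PreFrobenioid.Div (C.toElem π) ψ = PreFrobenioid.Div (C.toElem π) fC := by
      rw [PreFrobenioid.fiberProduct_div, PreFrobenioid.fiberProduct_div, e1]
    change PreFrobenioid.Div (C.toElem π) ψ = 1
    rw [key]
    exact hf
  · -- (b) invariance transfer
    have hfst : γ.fst ≫ fC.fst = fC.fst := congrArg CFP.Hom.fst h1
    have hsnd : γ.snd ≫ fC.snd = fC.snd := congrArg CFP.Hom.snd h1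
    have hdeg : C0.degFr γ.fst * C0.degFr fC.fst = C0.degFr fC.fst := by
      have h2 := congrArg C0.degFr hfst
      rwa [C0.degFr_comp'] at h2
    have hsc : (C0.Base γ.fst).act (C0.scalar fC.fst) * C0.scalar γ.fst ^ (C0.degFr fC.fst : ℕ) =
        C0.scalar fC.fst := by
      have h2 := congrArg C0.scalar hfst
      rwa [C0.scalar_comp'] at h2
    rw [hγb] at hsc
    unfold D0.Hom.act at hsc
    rw [D0.twists_id, D0.galAct_false] at hsc
    refine CFP.hom_ext (C0.hom_ext ?_ ?_ ?_) hsnd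
    · change C0.Base γ.fst ≫ C0.Base fC.fst = C0.Base fC.fst
      rw [hγb, Category.id_comp]
    · change C0.degFr γ.fst * C0.degFr fC.fst = C0.degFr fC.fst
      exact hdeg
    · change (C0.Base γ.fst).act (unitI * C0.scalar fC.fst) * C0.scalar γ.fst ^ (C0.degFr fC.fst : ℕ) =
        unitI * C0.scalar fC.fst
      rw [hγb]
      unfold D0.Hom.act
      rw [D0.twists_id, D0.galAct_false, mul_assoc, hsc]
  · -- (c) non-factorisation
    have hfst : fC.fst ≫ ψ'.fst = ψ₀ := congrArg CFP.Hom.fst hC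
    have hd1 : C0.degFr ψ'.fst = 1 := by
      have h2 := congrArg C0.degFr hfst
      rw [C0.degFr_comp'] at h2
      change C0.degFr fC.fst * C0.degFr ψ'.fst = C0.degFr fC.fst at h2
      exact mul_left_cancel (h2.trans (mul_one _).symm)
    have hmem : C0.scalar ψ'.fst ∈ D0.scalars D0.real := by
      rw [← hscA]
      exact ψ'.fst.scalar_mem
    have hs : C0.scalar ψ'.fst = unitI := by
      have h2 := congrArg C0.scalar hfst
      rw [C0.scalar_comp', hd1, PNat.one_coe, pow_one] at h2
      change (C0.Base fC.fst).act (C0.scalar ψ'.fst) * C0.scalar fC.fst = unitI * C0.scalar fC.fst at h2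
      unfold D0.Hom.act at h2
      rw [D0.galAct_eq_self_of_mem_scalars_real _ hmem] at h2
      exact mul_right_cancel h2
    rw [hs] at hmem
    exact unitI_not_mem_scalars_real hmem

end Twist

/-! ### Necessity of Galois saturation -/

section Necessity

variable {D : Type u} [Category.{v} D] (π : D ⥤ D0)

/-- **Unsaturated data.** If `(B_D → A_D, G_D)` is NOT Galois-saturated for `π`, then `π B_D` is complex,
`π A_D` is real, and `π` kills `G_D`. [cite: MochizukiFrdII2008, Prop 3.5 (i) p.34] -/
theorem of_not_galoisSaturated {BD AD : D} (fD : BD ⟶ AD) (GD : Subgroup (Aut BD))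
    (h : ¬ GaloisSaturated π fD GD) :
    (π.obj BD).IsComplex ∧ (π.obj AD).IsReal ∧ ∀ g ∈ GD, π.map g.hom = 𝟙 _ := by
  unfold GaloisSaturated at h
  push Not at h
  obtain ⟨σ, hσ, hne⟩ := h
  have hσ1 : σ ≠ 𝟙 _ := by
    intro hσ1
    apply hne 1 GD.one_mem
    rw [hσ1]
    exact π.map_id BD
  have hBc : (π.obj BD).IsComplex := D0.isComplex_of_endo_ne_id σ hσ1
  have hAr : (π.obj AD).IsReal := by
    rcases D0.isReal_or_isComplex (π.obj AD) with h' | h'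
    · exact h'
    · exact absurd (D0.eq_id_of_comp_eq_of_isComplex _ h' σ hσ) hσ1
  exact ⟨hBc, hAr, fun g hg => D0.eq_id_of_ne_of_ne_id σ _ hσ1 (hne g hg)⟩

/-- The base-compatibility clause of Prop. 3.5 (i) transports "`π` kills `G_D`" to "`π` kills the
`D`-components of `Γ`", hence (compatibility square of `C = C₀ ×_{D₀} D`) the `C₀`-components of `Γ` lie
over the identity. [cite: MochizukiFrdII2008, Prop 3.5 (i) p.34] -/
theorem base_fst_eq_id_of_compat {B : C π} {BD : D} (e : B.snd ≅ BD) {Γ : Subgroup (Aut B)}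
    {GD : Subgroup (Aut BD)} (φ : Γ ≃* GD)
    (hcompat : ∀ γ : Γ, (γ : Aut B).hom.snd ≫ e.hom = e.hom ≫ ((φ γ : GD) : Aut BD).hom)
    (hkill : ∀ g ∈ GD, π.map g.hom = 𝟙 _) (γ : Aut B) (hγ : γ ∈ Γ) :
    C0.Base γ.hom.fst = 𝟙 _ := by
  have h1 := congrArg π.map (hcompat ⟨γ, hγ⟩)
  rw [π.map_comp, π.map_comp, hkill _ (φ ⟨γ, hγ⟩).2, Category.comp_id] at h1
  have hD : π.map γ.hom.snd = 𝟙 _ := by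
    rw [← cancel_mono (π.map e.hom), Category.id_comp]
    exact h1
  have w := γ.hom.w
  rw [hD, Category.comp_id] at w
  exact (cancel_mono B.iso.hom).1 (w.trans (Category.id_comp _).symm)

/-- **Galois saturation is NECESSARY for Prop. 3.5 (i) at `H = C`.** [cite: MochizukiFrdII2008, Prop 3.5 (i) p.34] -/
theorem galoisSaturated_of_prop35i_C (hP : Prop35i_C π) (hRC : RC.IsOfRCIsoSubanchorType (baseRC π))
    (A : C π) {BD : D} (fD : BD ⟶ A.snd) (GD : Subgroup (Aut BD)) (hq : IsMonoMinimalQuotient GD fD) :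
    GaloisSaturated π fD GD := by
  by_contra hns
  obtain ⟨hBDc, hADr, hkill⟩ := of_not_galoisSaturated π fD GD hns
  obtain ⟨B, f, e, Γ, φ, -, -, hcompat, ⟨⟨hinv, huniq⟩, -⟩⟩ := hP hRC A BD fD GD hq
  change B.snd ≅ BD at e
  have hBc : B.fst.base.IsComplex := D0.isComplex_of_hom (B.iso.hom ≫ π.map e.hom) hBDc
  have hAr : A.fst.base.IsReal := UnitStab.D0.isReal_of_hom_real A.iso.inv hADr
  have hγb : ∀ γ ∈ Γ, C0.Base γ.hom.fst = 𝟙 _ :=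
    base_fst_eq_id_of_compat π e φ hcompat hkill
  obtain ⟨ψ, -, -, hinvT, hfacT⟩ := exists_phaseTwist' π hBc hAr f
  have hψ : ∀ γ ∈ Γ, γ.hom ≫ ψ = ψ := fun γ hγ => hinvT γ.hom (hγb γ hγ) (hinv γ hγ)
  obtain ⟨ψ', hψ', -⟩ := huniq ψ hψ
  exact hfacT ψ' hψ'

/-- **Galois saturation is NECESSARY for Prop. 3.5 (i) at `H = A`.** [cite: MochizukiFrdII2008, Prop 3.5 (i) p.34] -/
theorem galoisSaturated_of_prop35i_A (hP : Prop35i_A π) (hRC : RC.IsOfRCIsoSubanchorType (baseRC π))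
    (A' : C π) {BD : D} (fD : BD ⟶ A'.snd) (GD : Subgroup (Aut BD)) (hq : IsMonoMinimalQuotient GD fD) :
    GaloisSaturated π fD GD := by
  by_contra hns
  obtain ⟨hBDc, hADr, hkill⟩ := of_not_galoisSaturated π fD GD hns
  obtain ⟨B, f, e, Γ, φ, -, -, hcompat, ⟨⟨hinv, huniq⟩, -⟩⟩ := hP hRC (⟨A'⟩ : A π) BD fD GD hq
  change B.obj.snd ≅ BD at e
  have hBc : B.obj.fst.base.IsComplex := D0.isComplex_of_hom (B.obj.iso.hom ≫ π.map e.hom) hBDc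
  have hAr : A'.fst.base.IsReal := UnitStab.D0.isReal_of_hom_real A'.iso.inv hADr
  -- `Γ` read in `C` through the faithful inclusion `A ⊆ C`
  have hγb : ∀ γ ∈ Γ, C0.Base γ.hom.hom.fst = 𝟙 _ := by
    intro γ hγ
    have h1 := congrArg π.map (hcompat ⟨γ, hγ⟩)
    change π.map (γ.hom.hom.snd ≫ e.hom) = π.map (e.hom ≫ _) at h1
    rw [π.map_comp, π.map_comp, hkill _ (φ ⟨γ, hγ⟩).2, Category.comp_id] at h1
    have hD : π.map γ.hom.hom.snd = 𝟙 _ := by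
      rw [← cancel_mono (π.map e.hom), Category.id_comp]
      exact h1
    have w := γ.hom.hom.w
    rw [hD, Category.comp_id] at w
    exact (cancel_mono B.obj.iso.hom).1 (w.trans (Category.id_comp _).symm)
  obtain ⟨ψC, hisoT, -, hinvT, hfacT⟩ := exists_phaseTwist' π hBc hAr f.hom
  let ψ : B ⟶ (⟨A'⟩ : A π) := ⟨ψC, hisoT f.property⟩
  have hψ : ∀ γ ∈ Γ, γ.hom ≫ ψ = ψ := by
    intro γ hγ
    have h1 : γ.hom.hom ≫ f.hom = f.hom := by rw [← A.hom_comp_hom, hinv γ hγ]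
    exact A.hom_ext' π (hinvT γ.hom.hom (hγb γ hγ) h1)
  obtain ⟨ψ', hψ', -⟩ := huniq ψ hψ
  have hC : f.hom ≫ ψ'.hom = ψC := by rw [← A.hom_comp_hom, hψ']
  exact hfacT ψ'.hom hC

/-- **Galois saturation is NECESSARY for Prop. 3.5 (i) at `H = N`.** [cite: MochizukiFrdII2008, Prop 3.5 (i) p.34] -/
theorem galoisSaturated_of_prop35i_N (hP : Prop35i_N π) (hRC : RC.IsOfRCIsoSubanchorType (baseRC π))
    (A' : C π) {BD : D} (fD : BD ⟶ A'.snd) (GD : Subgroup (Aut BD)) (hq : IsMonoMinimalQuotient GD fD) :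
    GaloisSaturated π fD GD := by
  by_contra hns
  obtain ⟨hBDc, hADr, hkill⟩ := of_not_galoisSaturated π fD GD hns
  obtain ⟨B, f, e, Γ, φ, -, -, hcompat, ⟨⟨hinv, huniq⟩, -⟩⟩ := hP hRC (⟨⟨A'⟩⟩ : N π) BD fD GD hq
  change B.obj.obj.snd ≅ BD at e
  have hBc : B.obj.obj.fst.base.IsComplex :=
    D0.isComplex_of_hom (B.obj.obj.iso.hom ≫ π.map e.hom) hBDc
  have hAr : A'.fst.base.IsReal := UnitStab.D0.isReal_of_hom_real A'.iso.inv hADr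
  have hγb : ∀ γ ∈ Γ, C0.Base γ.hom.hom.hom.fst = 𝟙 _ := by
    intro γ hγ
    have h1 := congrArg π.map (hcompat ⟨γ, hγ⟩)
    change π.map (γ.hom.hom.hom.snd ≫ e.hom) = π.map (e.hom ≫ _) at h1
    rw [π.map_comp, π.map_comp, hkill _ (φ ⟨γ, hγ⟩).2, Category.comp_id] at h1
    have hD : π.map γ.hom.hom.hom.snd = 𝟙 _ := by
      rw [← cancel_mono (π.map e.hom), Category.id_comp]
      exact h1
    have w := γ.hom.hom.hom.w
    rw [hD, Category.comp_id] at w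
    exact (cancel_mono B.obj.obj.iso.hom).1 (w.trans (Category.id_comp _).symm)
  obtain ⟨ψC, hisoT, hdegT, hinvT, hfacT⟩ := exists_phaseTwist' π hBc hAr f.hom.hom
  have hψiso : PreFrobenioid.isometricMorphisms (C.toElem π) ψC := hisoT f.hom.property
  have hψlin : PreFrobenioid.linearMorphisms (A.toElem π) (⟨ψC, hψiso⟩ : B.obj ⟶ (⟨A'⟩ : A π)) := by
    have hl : C0.degFr f.hom.hom.fst = 1 := f.property
    change C0.degFr ψC.fst = 1
    rw [hdegT, hl]
  let ψ : B ⟶ (⟨⟨A'⟩⟩ : N π) := ⟨⟨ψC, hψiso⟩, hψlin⟩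
  have hψ : ∀ γ ∈ Γ, γ.hom ≫ ψ = ψ := by
    intro γ hγ
    have h1 : γ.hom.hom.hom ≫ f.hom.hom = f.hom.hom := by rw [← N.hom_hom_comp, hinv γ hγ]
    exact N.hom_ext' π (hinvT γ.hom.hom.hom (hγb γ hγ) h1)
  obtain ⟨ψ', hψ', -⟩ := huniq ψ hψ
  have hC : f.hom.hom ≫ ψ'.hom.hom = ψC := by rw [← N.hom_hom_comp, hψ']
  exact hfacT ψ'.hom.hom hC

end Necessity

/-! ### The characterisations -/

section Iff

variable {D : Type u} [Category.{v} D] (π : D ⥤ D0)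

/-- **[FrdII] Prop. 3.5 (i) for `H = C` AS TYPED holds iff every mono-minimal quotient datum under an
object of `C` is Galois-saturated for the base functor.** [cite: MochizukiFrdII2008, Prop 3.5 (i) p.34] -/
theorem prop35i_C_iff_saturated :
    Prop35i_C π ↔
      (RC.IsOfRCIsoSubanchorType (baseRC π) →
        ∀ (A : C π) (BD : D) (fD : BD ⟶ A.snd) (GD : Subgroup (Aut BD)),
          IsMonoMinimalQuotient GD fD → GaloisSaturated π fD GD) :=
  ⟨fun h hRC A _ fD GD hq => galoisSaturated_of_prop35i_C π h hRC A fD GD hq,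
    fun h hRC A BD fD GD hq => QuotientLift.prop35iR_C_holds π hRC A BD fD GD hq (h hRC A BD fD GD hq)⟩

/-- **[FrdII] Prop. 3.5 (i) for `H = A` AS TYPED holds iff every mono-minimal quotient datum under an
object of `C` is Galois-saturated for the base functor.** [cite: MochizukiFrdII2008, Prop 3.5 (i) p.34] -/
theorem prop35i_A_iff_saturated :
    Prop35i_A π ↔
      (RC.IsOfRCIsoSubanchorType (baseRC π) →
        ∀ (A : C π) (BD : D) (fD : BD ⟶ A.snd) (GD : Subgroup (Aut BD)),
          IsMonoMinimalQuotient GD fD → GaloisSaturated π fD GD) :=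
  ⟨fun h hRC A _ fD GD hq => galoisSaturated_of_prop35i_A π h hRC A fD GD hq,
    fun h hRC A BD fD GD hq =>
      QuotientLiftA.prop35iR_A_holds π hRC A BD fD GD hq (h hRC A.obj BD fD GD hq)⟩

/-- **[FrdII] Prop. 3.5 (i) for `H = N` AS TYPED holds iff every mono-minimal quotient datum under an
object of `C` is Galois-saturated for the base functor.** [cite: MochizukiFrdII2008, Prop 3.5 (i) p.34] -/
theorem prop35i_N_iff_saturated :
    Prop35i_N π ↔
      (RC.IsOfRCIsoSubanchorType (baseRC π) →
        ∀ (A : C π) (BD : D) (fD : BD ⟶ A.snd) (GD : Subgroup (Aut BD)),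
          IsMonoMinimalQuotient GD fD → GaloisSaturated π fD GD) :=
  ⟨fun h hRC A _ fD GD hq => galoisSaturated_of_prop35i_N π h hRC A fD GD hq,
    fun h hRC A BD fD GD hq =>
      QuotientLiftN.prop35iR_N_holds π hRC A BD fD GD hq (h hRC A.obj.obj BD fD GD hq)⟩

/-- **The instances at `A` and at `C` coincide** (both = Galois saturation of the quotient data).
[cite: MochizukiFrdII2008, Prop 3.5 (i) p.34] -/
theorem prop35i_A_iff_C : Prop35i_A π ↔ Prop35i_C π :=
  (prop35i_A_iff_saturated π).trans (prop35i_C_iff_saturated π).symm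

/-- **The instances at `N` and at `C` coincide** (both = Galois saturation of the quotient data).
[cite: MochizukiFrdII2008, Prop 3.5 (i) p.34] -/
theorem prop35i_N_iff_C : Prop35i_N π ↔ Prop35i_C π :=
  (prop35i_N_iff_saturated π).trans (prop35i_C_iff_saturated π).symm

/-- **All four typed instances of [FrdII] Prop. 3.5 (i) hold over a base all of whose mono-minimal
quotient data are Galois-saturated** (e.g. whenever the image of `π` on automorphism groups over real
objects reaches complex conjugation — the arithmetic situation of archimedean primes of number fields).
[cite: MochizukiFrdII2008, Prop 3.5 (i) p.34] -/
theorem prop35i_all_of_saturated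
    (h : ∀ (A : C π) (BD : D) (fD : BD ⟶ A.snd) (GD : Subgroup (Aut BD)),
      IsMonoMinimalQuotient GD fD → GaloisSaturated π fD GD) :
    Prop35i_C π ∧ Prop35i_A π ∧ Prop35i_N π ∧ Prop35i_R π :=
  ⟨(prop35i_C_iff_saturated π).2 fun _ => h, (prop35i_A_iff_saturated π).2 fun _ => h,
    (prop35i_N_iff_saturated π).2 fun _ => h, Prop35i_R_holds π⟩

end Iff

end ArchFrd

end

end Literature.AlgebraicGeometry.Frobenioids
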